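import Literature.AnabelianGeometry.EtaleTheta.ArithThetaTowerCThetaToBirat
import Literature.AnabelianGeometry.EtaleTheta.ArithThetaTowerConstFunctor
import Literature.AlgebraicGeometry.Frobenioids.BirationalizationProp44UnitsProofs
import Literature.AlgebraicGeometry.Frobenioids.BirationalizationRigidity
import Literature.AlgebraicGeometry.Frobenioids.ModelFrobenioidPullbacks
import Literature.AlgebraicGeometry.Frobenioids.MonoidFunctorsOnD
import HarnessLib

/-!
# [IUTchI] Ex. 3.2 (v) at the ARITHMETIC theta tower: birational triples `F(d)^÷ ≫ u ≫ (pull-back)^÷` in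
# `ℱ÷_v = ℱ̲_v^birat`, and the non-triviality of the theta divisor (GAP A item GA-16, file 1/2 — PROOF-ONLY)

S. Mochizuki, *Inter-universal Teichmüller Theory I* [Mochizuki2012], Ex. 3.2 (v) p.72 («`𝒞^Θ_v (⊆ ℱ÷_v)` — which may be
thought of as a subcategory of `ℱ÷_v`») [claim: Mochizuki2012, status: disputed] (D-0012 claim key; elementary LEMMAS over OUR
typed objects, nothing of the series asserted); S. Mochizuki, *The geometry of Frobenioids I* [MochizukiFrdI2008], Prop. 4.4 (i)
–(iv) pp.82–85 (the birationalization `C → C^birat`, `𝒪^×(A^birat) → Aut(A^birat)`; `C → C^birat` has epimorphic image arrows,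
the tree's `Birat.epi_toBirat_map`), Prop. 1.11 (iv) p.36 (a birational unit is determined by its composite with a pull-back
morphism, the tree's `BiratUnits.eq_of_toHom_comp_eq`), Thm. 5.2 (i)(ii) pp.100–101 (model Frobenioids: pull-back morphisms
are the linear divisor-free arrows, `ModelFrobenioid.isPullbackMorphism_of`); *The étale theta function …* [MochizukiEtTh2009]
Def. 3.6 (ii) p.77.  GAP A of record G-L5-EX32I-1, item GA-16 (D6: remaining laws + ASSEMBLY of `thetaRestBirat_of_carrierSpec`);
ruled shape `plan/L5/GAP-A-SIGNATURES.md` v1 §5, RULINGS #341 (B), #345 (D).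

WHAT IS HERE (support for the law `CThetaToBirat_faithful` of the slot `TemperedThetaRestBirat`, proved in file 2/2
`ArithThetaTowerThetaRestBirat.lean` together with the ASSEMBLY):
* §1 over ANY [EtTh] Def. 3.6 tempered Frobenioid `C` which is a Frobenioid (`hF`): the arrows of GA-06's functor
  `cThetaToBirat` (`ArithThetaTowerCThetaToBirat.lean` :261) are BIRATIONAL TRIPLES
  `toBirat (zeroHom d (𝟙 A)) ≫ BiratUnits.toHom u ≫ toBirat (zeroHom 1 f)` — Frobenius part, unit part, pull-back part — and
  `triple_cancel`: such a triple determines `d` (Frobenius degrees through `C^birat → F_{0_D}`), `f` (bases) and `u`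
  (`F(d)^÷` is an epimorphism of `C^birat`; `zeroHom 1 f` is a pull-back morphism of `C`, along which a birational unit is
  determined by its composite); `biratOps_base_map_triple`/`biratOps_degFr_triple` are the read-outs feeding the base
  compatibility `CThetaToBirat_base`.
* §2 `𝒟^Θ_v` / `𝒞^Θ_v` side: an arrow of `𝒟^Θ_v ⊆ (𝒟_v)_{Ÿ_v}` is determined by its underlying arrow of `𝒟_v`; an arrow of the
  MODEL Frobenioid `𝒞^Θ_v` is determined by (degree, base, unit) (the zero divisor is forced by relation (d) of [FrdI] Thm. 5.2 (i)).
* §3 the GENUINE theta divisor: `Div Θ̲_v = [Z] − [Pl] ≠ 0` in `Φ(Ÿ_T)^gp` (`Z` cuspidal `≠ 0`, `Pl` non-cuspidal: S0's `theta`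
  clause through `thetaFn_spec`, unique non-cuspidal × cuspidal decomposition; `Φ₀ → Φ` injective is GA-15's
  `CarrierSpec.ofLattice_injective`, `ArithThetaTowerConstFunctor.lean`), `Φ^gp` torsion-free,
  pull-backs of divisor classes injective — the facts by which a power `Θ̲|^n`, `n ≠ 0`, is never a constant of valuation zero
  (the S0-load-bearing step of the faithfulness proof; a Θ̲ with trivial divisor would fail exactly there).
carrier: genuine-by-[EtTh]-recipe on the T-lattice (Ÿ_T, Ÿ_T × V, X̲̲_v̲ × V) + constants everywhere; off-lattice Φ via
`rebase`/pullback; [EtTh] Def 3.3 Φ at general U and print's Ÿ̈/μ_N Kummer levels = FOUNDATIONS 13/14, not claimed (#322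
(c3′); this file defines no carrier).  HONEST FRAMING: PROOF-ONLY lemmas at OUR typed objects over a `Prop`-valued spec;
typed ≠ inhabited (the term is GA-12's) ≠ proved-in-print; an UNDISPUTED construction around [IUTchIII] Cor. 3.12, which stays
OPEN by charter (D-0045) — no side taken on it or on any author; nothing here asserts abc proved or refuted; count-neutral.
No def, no instance, no notation, no `sorry`.
-/

noncomputable section

namespace Literature.AnabelianGeometry.EtaleTheta

namespace ArithThetaTower

open CategoryTheory Opposite Function Literature.AlgebraicGeometry.Frobenioids Literature.AnabelianGeometry.SemiGraphs
  Literature.IUT.HodgeTheaters Literature.AlgebraicGeometry.Frobenioids.PadicFrd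

/-! ## §1 Birational triples in `ℱ̲^birat` of a tempered Frobenioid -/

section BiratTriple

universe u₀ v₀ u v w

variable {D₀ : Type u₀} [Category.{v₀} D₀] {T' : RealifiedDivisorMonoids (D₀ := D₀) treeMonoidVocabWeak.{w}}
  {Dv : Type u} [Category.{v} Dv] {VD : FrdICatStub.{u, v, w} Dv}
  (C : TemperedFrobenioid T' Dv VD)

/-- The linear, divisor-free, unit-free lift `(1, f, 0, 1) : T_A → T_{A'}` of an arrow `f : A → A'` of the base is a
pull-back morphism of the tempered Frobenioid ([FrdI] Thm. 5.2 (ii): pull-backs of a model Frobenioid are the linear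
morphisms with vanishing zero divisor; `Φ` divisorial by `hF`, `B` group-like). [cite: MochizukiFrdI2008, Thm. 5.2 (ii) p.101] -/
theorem isPullbackMorphism_zeroHom (hF : PreFrobenioid.IsFrobenioid C.toElem) {A A' : Dv} (f : A ⟶ A') :
    PreFrobenioid.IsPullbackMorphism C.toElem
      (ModelFrobenioid.zeroHom (Φ := C.divisorMonoid) (B := C.ratFnFunctor) (DivB := C.divBNatTrans) 1 f) :=
  ModelFrobenioid.isPullbackMorphism_of hF.isPreFrobenioid.isDivisorial C.objectwise_isGroupLike_weak rfl rfl

/-- `Base` of a birational triple `Frob_d ≫ u ≫ (1, f, 0, 1)` in `ℱ̲^birat → 𝒟` is `f` (units are base-identity,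
[FrdI] Prop. 4.4 (iii); `C → C^birat` lies over `𝒟`, Prop. 4.4 (i)). [cite: MochizukiFrdI2008, Prop. 4.4 (i) p.83] -/
theorem biratOps_base_map_triple (hF : PreFrobenioid.IsFrobenioid C.toElem) {A A' : Dv} (d : ℕ+)
    (u : PreFrobenioid.BiratUnits C.toElem hF (⟨A, 1⟩ : C.category)) (f : A ⟶ A') :
    (PreFrobenioid.biratOps hF (PreFrobenioid.hasBiratSquares_of_isFrobenioid hF)).base.map
      ((PreFrobenioid.toBirat C.toElem hF (PreFrobenioid.hasBiratSquares_of_isFrobenioid hF)).map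
          (ModelFrobenioid.zeroHom (Φ := C.divisorMonoid) (B := C.ratFnFunctor) (DivB := C.divBNatTrans) d (𝟙 A)) ≫
        PreFrobenioid.BiratUnits.toHom (PreFrobenioid.hasBiratSquares_of_isFrobenioid hF) u ≫
        (PreFrobenioid.toBirat C.toElem hF (PreFrobenioid.hasBiratSquares_of_isFrobenioid hF)).map
          (ModelFrobenioid.zeroHom (Φ := C.divisorMonoid) (B := C.ratFnFunctor) (DivB := C.divBNatTrans) 1 f)) = f := by
  have h1 := (PreFrobenioid.toAut_mem_unitsSubgroup (hsq := PreFrobenioid.hasBiratSquares_of_isFrobenioid hF) u).1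
  change (PreFrobenioid.biratOps hF _).base.map (PreFrobenioid.BiratUnits.toHom _ u) = 𝟙 _ at h1
  rw [Functor.map_comp, Functor.map_comp, PreFrobenioid.biratOps_base_map_toBirat,
    PreFrobenioid.biratOps_base_map_toBirat, h1]
  change 𝟙 A ≫ 𝟙 A ≫ f = f
  rw [Category.id_comp, Category.id_comp]

/-- `deg_Fr` of a birational triple `Frob_d ≫ u ≫ (1, f, 0, 1)` is `d` (units are linear; `C → C^birat` preserves
Frobenius degrees, [FrdI] Prop. 4.4 (i)). [cite: MochizukiFrdI2008, Prop. 4.4 (i) p.83] -/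
theorem biratOps_degFr_triple (hF : PreFrobenioid.IsFrobenioid C.toElem) {A A' : Dv} (d : ℕ+)
    (u : PreFrobenioid.BiratUnits C.toElem hF (⟨A, 1⟩ : C.category)) (f : A ⟶ A') :
    (PreFrobenioid.biratOps hF (PreFrobenioid.hasBiratSquares_of_isFrobenioid hF)).degFr
      ((PreFrobenioid.toBirat C.toElem hF (PreFrobenioid.hasBiratSquares_of_isFrobenioid hF)).map
          (ModelFrobenioid.zeroHom (Φ := C.divisorMonoid) (B := C.ratFnFunctor) (DivB := C.divBNatTrans) d (𝟙 A)) ≫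
        PreFrobenioid.BiratUnits.toHom (PreFrobenioid.hasBiratSquares_of_isFrobenioid hF) u ≫
        (PreFrobenioid.toBirat C.toElem hF (PreFrobenioid.hasBiratSquares_of_isFrobenioid hF)).map
          (ModelFrobenioid.zeroHom (Φ := C.divisorMonoid) (B := C.ratFnFunctor) (DivB := C.divBNatTrans) 1 f)) = d := by
  have h2 := (PreFrobenioid.toAut_mem_unitsSubgroup (hsq := PreFrobenioid.hasBiratSquares_of_isFrobenioid hF) u).2
  change (PreFrobenioid.biratOps hF _).degFr (PreFrobenioid.BiratUnits.toHom _ u) = 1 at h2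
  rw [PreFrobenioidData.degFr_comp, PreFrobenioidData.degFr_comp, PreFrobenioid.biratOps_degFr_toBirat,
    PreFrobenioid.biratOps_degFr_toBirat, h2]
  change d * (1 * 1) = d
  rw [mul_one, mul_one]

/-- **Cancellation for birational triples.** `Frob_d ≫ u ≫ (1, f, 0, 1) = Frob_{d'} ≫ u' ≫ (1, f', 0, 1)` in `ℱ̲^birat`
forces `d = d'` (Frobenius degrees), `f = f'` (bases) and `u = u'` — the image of `Frob_d` is an epimorphism of
`C^birat` ([FrdI] Prop. 4.4 (ii), total epimorphicity) and `(1, f, 0, 1)` is a pull-back morphism, along which a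
birational unit is determined by its composite ([FrdI] Prop. 1.11 (iv)). [cite: MochizukiFrdI2008, Prop. 4.4 (ii) p.83] -/
theorem triple_cancel (hF : PreFrobenioid.IsFrobenioid C.toElem) {A A' : Dv} {d d' : ℕ+}
    {u u' : PreFrobenioid.BiratUnits C.toElem hF (⟨A, 1⟩ : C.category)} {f f' : A ⟶ A'}
    (h : (PreFrobenioid.toBirat C.toElem hF (PreFrobenioid.hasBiratSquares_of_isFrobenioid hF)).map
          (ModelFrobenioid.zeroHom (Φ := C.divisorMonoid) (B := C.ratFnFunctor) (DivB := C.divBNatTrans) d (𝟙 A)) ≫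
        PreFrobenioid.BiratUnits.toHom (PreFrobenioid.hasBiratSquares_of_isFrobenioid hF) u ≫
        (PreFrobenioid.toBirat C.toElem hF (PreFrobenioid.hasBiratSquares_of_isFrobenioid hF)).map
          (ModelFrobenioid.zeroHom (Φ := C.divisorMonoid) (B := C.ratFnFunctor) (DivB := C.divBNatTrans) 1 f) =
      (PreFrobenioid.toBirat C.toElem hF (PreFrobenioid.hasBiratSquares_of_isFrobenioid hF)).map
          (ModelFrobenioid.zeroHom (Φ := C.divisorMonoid) (B := C.ratFnFunctor) (DivB := C.divBNatTrans) d' (𝟙 A)) ≫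
        PreFrobenioid.BiratUnits.toHom (PreFrobenioid.hasBiratSquares_of_isFrobenioid hF) u' ≫
        (PreFrobenioid.toBirat C.toElem hF (PreFrobenioid.hasBiratSquares_of_isFrobenioid hF)).map
          (ModelFrobenioid.zeroHom (Φ := C.divisorMonoid) (B := C.ratFnFunctor) (DivB := C.divBNatTrans) 1 f')) :
    d = d' ∧ f = f' ∧ u = u' := by
  have hd : d = d' := by
    have e := congrArg (PreFrobenioid.biratOps hF (PreFrobenioid.hasBiratSquares_of_isFrobenioid hF)).degFr h
    rwa [biratOps_degFr_triple, biratOps_degFr_triple] at e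
  have hf : f = f' := by
    have e := congrArg (PreFrobenioid.biratOps hF (PreFrobenioid.hasBiratSquares_of_isFrobenioid hF)).base.map h
    rwa [biratOps_base_map_triple, biratOps_base_map_triple] at e
  subst hd hf
  refine ⟨rfl, rfl, ?_⟩
  haveI := PreFrobenioid.Birat.epi_toBirat_map hF (PreFrobenioid.hasBiratSquares_of_isFrobenioid hF)
    (ModelFrobenioid.zeroHom (Φ := C.divisorMonoid) (B := C.ratFnFunctor) (DivB := C.divBNatTrans) d (𝟙 A))
  exact PreFrobenioid.BiratUnits.eq_of_toHom_comp_eq (isPullbackMorphism_zeroHom C hF f) ((cancel_epi _).mp h)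

end BiratTriple

/-! ## §2 Arrows of `𝒟^Θ_v` and of `𝒞^Θ_v` are determined by few components -/

section CThetaSide

variable {p : ℕ} [Fact p.Prime] (d : GaloisValDatum.{0} p) {P : Type} [Group P] [TopologicalSpace P]
  (T : BadLocalGroupDatum d.Gal P)

/-- Arrows of `𝒟^Θ_v ⊆ (𝒟_v)_{Ÿ_v}` are determined by their underlying arrows of `𝒟_v` (the inclusion is faithful and an
arrow of the slice is its left component). ([IUTchI] Ex 3.2 (v) p.72) [claim: Mochizuki2012, status: disputed] -/
theorem dTheta_hom_ext {X Y : T.DTheta} {a b : X ⟶ Y}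
    (h : (T.dThetaIncl.map a).left = (T.dThetaIncl.map b).left) : a = b :=
  T.dThetaIncl.map_injective (Over.OverMorphism.ext h)

variable {q : intNonzero d.k} (hq : ¬ IsUnit q)

/-- An arrow of `𝒞^Θ_v` is determined by its Frobenius degree, its projection to `𝒟^Θ_v` and its unit `u_φ`: the zero
divisor is then forced by the relation (d) of [FrdI] Thm. 5.2 (i), `Φ_{𝒞^Θ_v} = ℕ·log(q̲)` being integral (monoprime).
([IUTchI] Ex 3.2 (v) p.72) [claim: Mochizuki2012, status: disputed] -/
theorem cTheta_hom_ext {X Y : T.CTheta d hq} {φ ψ : X ⟶ Y} (h₁ : ModelFrobenioid.degFr φ = ModelFrobenioid.degFr ψ)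
    (h₂ : ModelFrobenioid.baseMap φ = ModelFrobenioid.baseMap ψ) (h₄ : ModelFrobenioid.unit φ = ModelFrobenioid.unit ψ) :
    φ = ψ := by
  have rφ := ModelFrobenioid.rel φ
  rw [h₁, h₂, h₄, ← ModelFrobenioid.rel ψ] at rφ
  exact ModelFrobenioid.hom_ext h₁ h₂
    (((T.thetaDatum d hq).isMonoprime (op X.base)).isDivisorial.isPreDivisorial.isIntegral.injective_of
      (mul_left_cancel rφ)) h₄

end CThetaSide

/-! ## §3 The theta divisor is non-trivial; `Φ^gp` is torsion-free; pull-backs and the lattice map are injective -/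

section ThetaDivisor

variable {p : ℕ} [Fact p.Prime] {d : GaloisValDatum.{0} p} {P : Type} [Group P] [TopologicalSpace P]
  {T : BadLocalGroupDatum d.Gal P}
  {T' : RealifiedDivisorMonoids (D₀ := T.Dv) treeMonoidVocabWeak.{0}} {VD : FrdICatStub.{0, 0, 0} T.Dv}
  {C : TemperedFrobenioid T' T.Dv VD}

/-- `Φ(A)^gp` is torsion-free when `Φ(A)` is divisorial (saturated: a class with a power in `Φ(A)` lies in `Φ(A)`;
integral; sharp: no non-trivial units, hence no torsion) — here for the divisor monoid of a tempered Frobenioid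
which is a Frobenioid. [cite: MochizukiFrdI2008, Def. 1.1 (i) p.19] -/
theorem gp_eq_one_of_pow_eq_one (hF : PreFrobenioid.IsFrobenioid C.toElem) (A : T.Dvᵒᵖ)
    {x : Algebra.GrothendieckGroup (C.Φ.carrier A)} {n : ℕ} (hn : 0 < n) (hx : x ^ n = 1) : x = 1 := by
  have hdiv : IsDivisorial (C.Φ.carrier A) := hF.isPreFrobenioid.isDivisorial (unop A)
  obtain ⟨c, hc⟩ := hdiv.isPreDivisorial.isSaturated.mem_range_of_pow_mem_range x n hn ⟨1, by rw [hx, map_one]⟩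
  have hcn : c ^ n = 1 := hdiv.isPreDivisorial.isIntegral.injective_of (by rw [map_pow, hc, hx, map_one])
  rw [← hc, hdiv.isSharp.isTorsionFree.eq_one_of_pow_eq_one c n hn hcn, map_one]

/-- Pull-back of divisor classes `Φ(A)^gp → Φ(B)^gp` along an arrow of `𝒟_v̲` is injective (`Φ` is a monoid on `𝒟`:
pull-backs characteristically injective, [FrdI] Def. 1.1 (ii)(a); groupification preserves injectivity between integral
monoids). [cite: MochizukiFrdI2008, Def. 1.1 (ii) p.20] -/
theorem gpMap_pull_injective (hF : PreFrobenioid.IsFrobenioid C.toElem) {A B : T.Dvᵒᵖ} (f : A ⟶ B) :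
    Injective (gpMap (C.Φ.pull f)) := by
  haveI : IsCancelMul (C.Φ.carrier A) :=
    isIntegral_iff_isCancelMul.mp (hF.isPreFrobenioid.isDivisorial (unop A)).isPreDivisorial.isIntegral
  haveI : IsCancelMul (C.Φ.carrier B) :=
    isIntegral_iff_isCancelMul.mp (hF.isPreFrobenioid.isDivisorial (unop B)).isPreDivisorial.isIntegral
  exact gpMap_injective _ (hF.isPreFrobenioid.isMonoidOn.isCharInjective f.unop).1

/-- The cuspidal zeros and the non-cuspidal poles of `θ` are distinct elements of the lattice `Φ₀(Ÿ_T)` (unique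
non-cuspidal × cuspidal decomposition, `Z ≠ 0`). [cite: MochizukiEtTh2009, Def 3.6 p.77] -/
theorem CarrierSpec.thetaZeros_ne_thetaPoles (hC : CarrierSpec d T C) : hC.thetaZeros ≠ hC.thetaPoles := by
  intro h
  obtain ⟨hZ, hPl, hZ1, -, -, -⟩ := hC.thetaFn_spec
  obtain ⟨q, -, huniq⟩ := T'.existsUnique_ncsp_csp (op T.ydd) hC.thetaZeros
  have e₁ := huniq (⟨1, one_mem _⟩, ⟨hC.thetaZeros, hZ⟩) (one_mul _)
  have e₂ := huniq (⟨hC.thetaPoles, hPl⟩, ⟨1, one_mem _⟩) (by rw [h]; exact mul_one _)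
  have e := congrArg (fun q : T'.ncsp₀ (op T.ydd) × T'.csp₀ (op T.ydd) => (q.2 : T'.Φ₀.obj (op T.ydd))) (e₁.trans e₂.symm)
  exact hZ1 e

/-- **The birational divisor of `Θ̲_v` is non-trivial**: `[Z] − [Pl] ≠ 0` in `Φ(Ÿ_T)^gp`.
[cite: MochizukiFrdI2008, Thm. 5.2 (ii) p.101] -/
theorem divHom_theta_ne_one (hC : CarrierSpec d T C) (hF : PreFrobenioid.IsFrobenioid C.toElem) :
    PreFrobenioid.BiratUnits.divHom hF (⟨T.ydd, 1⟩ : C.category) (theta hC hF) ≠ 1 := by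
  rw [divHom_theta]
  intro h
  have h' : (Algebra.GrothendieckGroup.of (hC.ofLattice T.ydd hC.thetaZeros) :
      Algebra.GrothendieckGroup (C.Φ.carrier (op T.ydd))) /
        Algebra.GrothendieckGroup.of (hC.ofLattice T.ydd hC.thetaPoles) = 1 := h
  rw [div_eq_one] at h'
  exact hC.thetaZeros_ne_thetaPoles (hC.ofLattice_injective T.ydd
    ((hF.isPreFrobenioid.isDivisorial T.ydd).isPreDivisorial.isIntegral.injective_of h'))

/-- The `Φ^gp`-component of the Θ̈-fraction is non-trivial (same statement read in `B(Ÿ_T)`).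
[cite: MochizukiEtTh2009, Def 3.6 p.77] -/
theorem divB_thetaRatFn_ne_one (hC : CarrierSpec d T C) (hF : PreFrobenioid.IsFrobenioid C.toElem) :
    (C.divBNatTrans.app (op T.ydd)).hom (thetaRatFn hC) ≠ 1 := by
  rw [divB_thetaRatFn]
  intro h
  have h' : (Algebra.GrothendieckGroup.of (hC.ofLattice T.ydd hC.thetaZeros) :
      Algebra.GrothendieckGroup (C.Φ.carrier (op T.ydd))) /
        Algebra.GrothendieckGroup.of (hC.ofLattice T.ydd hC.thetaPoles) = 1 := h
  rw [div_eq_one] at h'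
  exact hC.thetaZeros_ne_thetaPoles (hC.ofLattice_injective T.ydd
    ((hF.isPreFrobenioid.isDivisorial T.ydd).isPreDivisorial.isIntegral.injective_of h'))

end ThetaDivisor

end ArithThetaTower

end Literature.AnabelianGeometry.EtaleTheta

end
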